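/-
Copyright (c) 2026. All rights reserved.
Released under Apache 2.0 license as described in the file LICENSE.
Authors: hodgecm-mathlib cell (D-0151), fan A, seat A-p10.
-/
import Literature.NumberTheory.Automorphic.UnitaryGroupIsotropicLineElements
import HarnessLib

/-!
# Quasi-reflections along an arbitrary vector and transitivity of `U(σ, H)` on the non-isotropic level sets
# `{x : h(x,x) = β}`, `β ≠ 0` (Witt's theorem for hermitian lines)

Topic `NumberTheory/Automorphic`; namespace `Literature.NumberTheory.Automorphic.UnitaryGroup` (continues
`UnitaryGroupIsotropicLineElements`: `hermForm σ H`, `hermRow σ H`, `mem_unitaryGroupOfForm_iff_hermForm`, and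
`UnitaryGroupLocalReflections` §1: quasi-reflections along `σ`-FIXED vectors of a symmetric Gram matrix).  KERNEL ONLY:
theorems; no definition, no named fact, no instance, no `sorry`.

SETTING.  `S` a commutative ring with a ring endomorphism `σ` (an involution where stated: `hσ : ∀ s, σ (σ s) = s`),
`H ∈ Mₙ(S)` `σ`-hermitian where stated (`hH : (H.map σ)ᵀ = H`), `h = hermForm σ H` (`σ`-semilinear in the first
variable, linear in the second), `U(σ, H) = unitaryGroupOfForm σ H ≤ GLₙ(S)`.

* §1 **quasi-reflections along an ARBITRARY vector `v`** ([Dieudonne1971GroupesClassiques, Chap. II §4]: «quasi-symétries»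
  and «transvections unitaires» `z ↦ z + a h(v, z) v`, isometries exactly when `a + σ a + a σ(a) h(v, v) = 0`): the matrix
  `1 + a • v ⊗ hermRow v` acts by `z ↦ z + (a h(v,z)) • v` (`quasiRefl_mulVec`), multiplies `v` by `1 + a h(v,v)`, fixes
  `v^⊥` pointwise, composes along one vector by `(a, b) ↦ a + b + a b h(v,v)` (`quasiRefl_mul_quasiRefl`), is an
  ISOMETRY of `h` under Dieudonné's relation (`hermForm_quasiRefl_mulVec`, any `σ`-involution and hermitian `H`), and is
  then a unit with inverse the quasi-reflection of parameter `σ a` lying in `U(σ, H)`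
  (`exists_mem_unitaryGroupOfForm_coe_eq_quasiRefl`).
* §2 **one quasi-reflection moves `x` to `y`** when `h(x,x) = h(y,y)` and `c := h(x − y, x)` is a unit: the parameter
  `a = −c⁻¹` along `v = x − y` satisfies Dieudonné's relation AUTOMATICALLY (`h(x−y, x−y) = c + σ c`) and
  `q x = y` (`exists_mem_unitaryGroupOfForm_mulVec_eq_of_isUnit`).
* §3 **TRANSITIVITY ON NON-ISOTROPIC LEVEL SETS** over a field `K` with `2 ≠ 0`: for `h(x,x) = h(y,y) = β ≠ 0` there is
  `g ∈ U(σ, H)` with `g x = y` (**`exists_mem_unitaryGroupOfForm_mulVec_eq`**) — if `h(x,y) ≠ β` one quasi-reflection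
  (§2), otherwise `x ↦ −y` by §2 (now `h(x,−y) = −β ≠ β`) followed by the quasi-reflection along `y` of parameter `−2/β`
  (`y ↦ −y`).  Equivalently: the level set `{x : h(x,x) = β}` is ONE `U(σ,H)`-orbit (`mulVec` orbit form
  `exists_mem_unitaryGroupOfForm_mulVec_eq_iff`).  This is Witt's extension theorem for non-degenerate LINES of a
  hermitian space ([Dieudonne1971GroupesClassiques, Chap. II §4 n° 7–8]; [Scharlau1985HermitianForms Ch. 7 §9]) with an explicit
  two-step witness, valid for any field with involution of characteristic `≠ 2` and any (possibly degenerate) hermitian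
  `H` — no non-degeneracy of `H` is needed for non-isotropic vectors.

USE (cell `hodgecm-mathlib`, FLOOR-0 P4, ENGINE E-2 child `Cruxes/H413/Lines/F0_E2SiegelWeilWeilRange.lean`, stub
`stub_SW2_siegelWeil`, the IDENTITY road = [Weil1965, Thm. 5] at rank one): the theta integral `I□` unfolds over the
`U(V)(F)`-orbits `U(i)_F = {x ∈ V(F) : h(x,x) = i}`, each of which is ONE orbit `U(V)(F) · x_i` for `i ≠ 0` by
`exists_mem_unitaryGroupOfForm_mulVec_eq` (`K = E`, `σ` the CM involution); Weil's hypothesis «`G'_v` opère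
transitivement sur `U(i)_v`» at the auxiliary place is the same theorem over `E_v` for `i ≠ 0`.  HC_CM is proved only
modulo the printed citations until rung 0 closes.

## References
* [Dieudonne1971GroupesClassiques] J. Dieudonné, *La géométrie des groupes classiques*, 3e éd. (1971), Chap. II §4
  (quasi-symétries, transvections unitaires), §5.
* [Scharlau1985HermitianForms] W. Scharlau, *Quadratic and Hermitian Forms*, Grundlehren 270 (1985), Ch. 7 §9 (Witt's theorem for
  hermitian forms).
* [Weil1965] A. Weil, Acta Math. 113 (1965) 1–87, n° 51–52 (Thm. 5: «`G'_v` … opère transitivement sur `U(i)_v`»).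
-/

set_option autoImplicit false

noncomputable section

namespace Literature.NumberTheory.Automorphic.UnitaryGroup

open _root_.Matrix

/-! ## §1 Quasi-reflections along an arbitrary vector -/

section QuasiReflection

variable {S : Type*} [CommRing S] (σ : S →+* S) {n : Type*} [Fintype n] [DecidableEq n] (H : Matrix n n S)

omit [DecidableEq n] in
/-- `(u ⊗ r) z = ⟨r, z⟩ u` over a commutative ring. [folklore] -/
private theorem vecMulVec_mulVec_eq_smul' (u r z : n → S) : Matrix.vecMulVec u r *ᵥ z = (r ⬝ᵥ z) • u := by
  rw [Matrix.vecMulVec_mulVec]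
  funext i
  simp [mul_comm]

/-- **action of the quasi-reflection along `v` with parameter `a`**: `(1 + a • v ⊗ hermRow v) z = z + (a h(v,z)) • v`.
[cite: Dieudonne1971GroupesClassiques, Chap. II §4] -/
theorem quasiRefl_mulVec (v : n → S) (a : S) (z : n → S) :
    (1 + a • Matrix.vecMulVec v (hermRow σ H v)) *ᵥ z = z + (a * hermForm σ H v z) • v := by
  rw [Matrix.add_mulVec, Matrix.one_mulVec, Matrix.smul_mulVec, vecMulVec_mulVec_eq_smul', hermRow_dotProduct,
    smul_smul]

/-- the quasi-reflection multiplies `v` by `1 + a h(v,v)`. [cite: Dieudonne1971GroupesClassiques, Chap. II §4] -/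
theorem quasiRefl_mulVec_self (v : n → S) (a : S) :
    (1 + a • Matrix.vecMulVec v (hermRow σ H v)) *ᵥ v = (1 + a * hermForm σ H v v) • v := by
  rw [quasiRefl_mulVec, add_smul, one_smul]

/-- the quasi-reflection fixes `v^⊥` pointwise. [cite: Dieudonne1971GroupesClassiques, Chap. II §4] -/
theorem quasiRefl_mulVec_of_orth (v : n → S) (a : S) {z : n → S} (hvz : hermForm σ H v z = 0) :
    (1 + a • Matrix.vecMulVec v (hermRow σ H v)) *ᵥ z = z := by
  rw [quasiRefl_mulVec, hvz, mul_zero, zero_smul, add_zero]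

/-- **composition along one vector**: `q_{v,a} q_{v,b} = q_{v, a + b + a b h(v,v)}`. [cite: Dieudonne1971GroupesClassiques, Chap. II §4] -/
theorem quasiRefl_mul_quasiRefl (v : n → S) (a b : S) :
    (1 + a • Matrix.vecMulVec v (hermRow σ H v)) * (1 + b • Matrix.vecMulVec v (hermRow σ H v)) =
      1 + (a + b + a * b * hermForm σ H v v) • Matrix.vecMulVec v (hermRow σ H v) := by
  rw [add_mul, one_mul, mul_add, mul_one, Matrix.smul_mul, Matrix.mul_smul, Matrix.vecMulVec_mul_vecMulVec,
    hermRow_dotProduct, Matrix.vecMulVec_smul, smul_smul, smul_smul]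
  module

omit [DecidableEq n] in
/-- **Dieudonné's relation is symmetric under `a ↔ σ a`** (commutativity of `S`).
[cite: Dieudonne1971GroupesClassiques, Chap. II §4] -/
theorem quasiRefl_relation_conj {v : n → S} {a : S}
    (ha : a + σ a + a * σ a * hermForm σ H v v = 0) : σ a + a + σ a * a * hermForm σ H v v = 0 := by
  linear_combination ha

/-- **quasi-reflections are isometries under Dieudonné's relation** `a + σ a + a σ(a) h(v,v) = 0` (`σ` an involution,
`H` hermitian; `v` arbitrary): `h(q z, q w) = h(z, w)`. [cite: Dieudonne1971GroupesClassiques, Chap. II §4] -/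
theorem hermForm_quasiRefl_mulVec (hσ : ∀ s, σ (σ s) = s) (hH : (H.map σ)ᵀ = H) {v : n → S} {a : S}
    (ha : a + σ a + a * σ a * hermForm σ H v v = 0) (z w : n → S) :
    hermForm σ H ((1 + a • Matrix.vecMulVec v (hermRow σ H v)) *ᵥ z)
        ((1 + a • Matrix.vecMulVec v (hermRow σ H v)) *ᵥ w) = hermForm σ H z w := by
  have hzv : hermForm σ H z v = σ (hermForm σ H v z) := (conj_hermForm σ H hσ hH v z).symm
  rw [quasiRefl_mulVec, quasiRefl_mulVec]
  simp only [hermForm_add_left, hermForm_add_right, hermForm_smul_left_eq, hermForm_smul_right, map_mul, hzv]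
  linear_combination (σ (hermForm σ H v z) * hermForm σ H v w) * ha

/-- `q_{v,a} q_{v,σa} = 1` under Dieudonné's relation. [cite: Dieudonne1971GroupesClassiques, Chap. II §4] -/
theorem quasiRefl_mul_quasiRefl_conj {v : n → S} {a : S}
    (ha : a + σ a + a * σ a * hermForm σ H v v = 0) :
    (1 + a • Matrix.vecMulVec v (hermRow σ H v)) * (1 + σ a • Matrix.vecMulVec v (hermRow σ H v)) = 1 := by
  rw [quasiRefl_mul_quasiRefl, ha, zero_smul, add_zero]

/-- `q_{v,σa} q_{v,a} = 1` under Dieudonné's relation. [cite: Dieudonne1971GroupesClassiques, Chap. II §4] -/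
theorem quasiRefl_conj_mul_quasiRefl {v : n → S} {a : S}
    (ha : a + σ a + a * σ a * hermForm σ H v v = 0) :
    (1 + σ a • Matrix.vecMulVec v (hermRow σ H v)) * (1 + a • Matrix.vecMulVec v (hermRow σ H v)) = 1 := by
  rw [quasiRefl_mul_quasiRefl, quasiRefl_relation_conj σ H ha, zero_smul, add_zero]

/-- **the quasi-reflection as an element of `U(σ, H)`**: under Dieudonné's relation there is `g ∈ U(σ, H) ≤ GLₙ(S)` whose
matrix is `1 + a • v ⊗ hermRow v` (inverse: the quasi-reflection of parameter `σ a`).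
[cite: Dieudonne1971GroupesClassiques, Chap. II §4] -/
theorem exists_mem_unitaryGroupOfForm_coe_eq_quasiRefl (hσ : ∀ s, σ (σ s) = s) (hH : (H.map σ)ᵀ = H) {v : n → S}
    {a : S} (ha : a + σ a + a * σ a * hermForm σ H v v = 0) :
    ∃ g ∈ unitaryGroupOfForm σ H, (g : Matrix n n S) = 1 + a • Matrix.vecMulVec v (hermRow σ H v) := by
  refine ⟨⟨1 + a • Matrix.vecMulVec v (hermRow σ H v), 1 + σ a • Matrix.vecMulVec v (hermRow σ H v),
    quasiRefl_mul_quasiRefl_conj σ H ha, quasiRefl_conj_mul_quasiRefl σ H ha⟩, ?_, rfl⟩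
  rw [mem_unitaryGroupOfForm_iff_hermForm]
  exact hermForm_quasiRefl_mulVec σ H hσ hH ha

end QuasiReflection

/-! ## §2 One quasi-reflection moves `x` to `y` when `h(x − y, x)` is a unit -/

section OneStep

variable {S : Type*} [CommRing S] (σ : S →+* S) {n : Type*} [Fintype n] [DecidableEq n] (H : Matrix n n S)

/-- `h(x,x)` is `σ`-fixed. [cite: Dieudonne1971GroupesClassiques, Chap. II §4] -/
theorem conj_hermForm_self (hσ : ∀ s, σ (σ s) = s) (hH : (H.map σ)ᵀ = H) (x : n → S) :
    σ (hermForm σ H x x) = hermForm σ H x x :=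
  conj_hermForm σ H hσ hH x x

/-- **the key identity**: for `h(x,x) = h(y,y)`, `h(x − y, x − y) = c + σ c` with `c := h(x − y, x)`.
[cite: Dieudonne1971GroupesClassiques, Chap. II §4] -/
theorem hermForm_sub_sub_eq (hσ : ∀ s, σ (σ s) = s) (hH : (H.map σ)ᵀ = H) {x y : n → S}
    (hxy : hermForm σ H x x = hermForm σ H y y) :
    hermForm σ H (x - y) (x - y) = hermForm σ H (x - y) x + σ (hermForm σ H (x - y) x) := by
  have h1 : σ (hermForm σ H (x - y) x) = hermForm σ H x (x - y) := conj_hermForm σ H hσ hH (x - y) x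
  rw [h1, hermForm_sub_left, hermForm_sub_left, hermForm_sub_right, hermForm_sub_right, ← hxy]
  ring

/-- **Dieudonné's relation holds automatically** for `v = x − y`, `a = −c⁻¹`, `c = h(x − y, x)` a unit, `h(x,x) = h(y,y)`.
[cite: Dieudonne1971GroupesClassiques, Chap. II §4] -/
theorem quasiRefl_relation_of_isUnit (hσ : ∀ s, σ (σ s) = s) (hH : (H.map σ)ᵀ = H) {x y : n → S}
    (hxy : hermForm σ H x x = hermForm σ H y y) (hc : IsUnit (hermForm σ H (x - y) x)) :
    (-((hc.unit⁻¹ : Sˣ) : S)) + σ (-((hc.unit⁻¹ : Sˣ) : S)) +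
        (-((hc.unit⁻¹ : Sˣ) : S)) * σ (-((hc.unit⁻¹ : Sˣ) : S)) * hermForm σ H (x - y) (x - y) = 0 := by
  set c : S := hermForm σ H (x - y) x with hc_def
  set u : S := ((hc.unit⁻¹ : Sˣ) : S) with hu_def
  have hcu : c * u = 1 := IsUnit.mul_val_inv hc
  have hσcu : σ c * σ u = 1 := by rw [← map_mul, hcu, map_one]
  rw [hermForm_sub_sub_eq σ H hσ hH hxy, ← hc_def, map_neg]
  linear_combination (σ u) * hcu + u * hσcu

/-- **one quasi-reflection moves `x` to `y`**: if `h(x,x) = h(y,y)` and `c := h(x − y, x)` is a unit, then the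
quasi-reflection along `x − y` with parameter `−c⁻¹` is an isometry (Dieudonné's relation holds automatically, since
`h(x−y, x−y) = c + σ c`) and sends `x ↦ y`. [cite: Dieudonne1971GroupesClassiques, Chap. II §4 n° 7–8] -/
theorem exists_mem_unitaryGroupOfForm_mulVec_eq_of_isUnit (hσ : ∀ s, σ (σ s) = s) (hH : (H.map σ)ᵀ = H)
    {x y : n → S} (hxy : hermForm σ H x x = hermForm σ H y y) (hc : IsUnit (hermForm σ H (x - y) x)) :
    ∃ g ∈ unitaryGroupOfForm σ H, (g : Matrix n n S) *ᵥ x = y := by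
  have hrel := quasiRefl_relation_of_isUnit σ H hσ hH hxy hc
  obtain ⟨g, hg, hcoe⟩ := exists_mem_unitaryGroupOfForm_coe_eq_quasiRefl σ H hσ hH hrel
  refine ⟨g, hg, ?_⟩
  rw [hcoe, quasiRefl_mulVec, neg_mul, IsUnit.val_inv_mul, neg_smul, one_smul]
  abel

end OneStep

/-! ## §3 Transitivity on non-isotropic level sets over a field -/

section Field

variable {K : Type*} [Field K] (σ : K →+* K) {n : Type*} [Fintype n] [DecidableEq n] (H : Matrix n n K)

/-- **the quasi-reflection along a non-isotropic `y` with parameter `−2/h(y,y)` lies in `U(σ, H)` and sends `y ↦ −y`**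
(the hermitian SYMMETRY of the line `K y`). [cite: Dieudonne1971GroupesClassiques, Chap. II §4] -/
theorem exists_mem_unitaryGroupOfForm_mulVec_eq_neg (hσ : ∀ s, σ (σ s) = s) (hH : (H.map σ)ᵀ = H)
    (h2 : σ 2 = 2) {y : n → K} (hy : hermForm σ H y y ≠ 0) :
    ∃ g ∈ unitaryGroupOfForm σ H, (g : Matrix n n K) *ᵥ y = -y := by
  set β : K := hermForm σ H y y with hβ_def
  have hβσ : σ β = β := conj_hermForm_self σ H hσ hH y
  have ha : (-(2 / β)) + σ (-(2 / β)) + (-(2 / β)) * σ (-(2 / β)) * hermForm σ H y y = 0 := by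
    rw [map_neg, map_div₀, h2, hβσ, ← hβ_def]
    field_simp
    ring
  obtain ⟨g, hg, hcoe⟩ := exists_mem_unitaryGroupOfForm_coe_eq_quasiRefl σ H hσ hH ha
  refine ⟨g, hg, ?_⟩
  rw [hcoe, quasiRefl_mulVec_self, ← hβ_def]
  have h1 : (1 + -(2 / β) * β) = (-1 : K) := by field_simp; ring
  rw [h1, neg_one_smul]

/-- a ring endomorphism fixes `2`. [folklore] -/
private theorem map_two (σ : K →+* K) : σ 2 = 2 := map_ofNat σ 2

/-- **TRANSITIVITY OF `U(σ, H)` ON NON-ISOTROPIC LEVEL SETS** (Witt's theorem for hermitian lines, explicit form): over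
a field `K` of characteristic `≠ 2` with an involution `σ` and a `σ`-hermitian `H`, if `h(x,x) = h(y,y) = β ≠ 0` then
some `g ∈ U(σ, H)` sends `x ↦ y` — one quasi-reflection if `h(x,y) ≠ β`, else `x ↦ −y ↦ y` by two.
[cite: Dieudonne1971GroupesClassiques, Chap. II §4 n° 7–8] [cite: Scharlau1985HermitianForms, Ch. 7 §9] -/
theorem exists_mem_unitaryGroupOfForm_mulVec_eq (hσ : ∀ s, σ (σ s) = s) (hH : (H.map σ)ᵀ = H) (h2 : (2 : K) ≠ 0)
    {x y : n → K} {β : K} (hx : hermForm σ H x x = β) (hy : hermForm σ H y y = β) (hβ : β ≠ 0) :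
    ∃ g ∈ unitaryGroupOfForm σ H, (g : Matrix n n K) *ᵥ x = y := by
  have hβσ : σ β = β := by rw [← hx]; exact conj_hermForm_self σ H hσ hH x
  by_cases ht : hermForm σ H x y = β
  · -- two steps: `x ↦ −y ↦ y`
    have hxy' : hermForm σ H x x = hermForm σ H (-y) (-y) := by
      rw [hermForm_neg_left, hermForm_neg_right, neg_neg, hx, hy]
    have hc : IsUnit (hermForm σ H (x - -y) x) := by
      rw [sub_neg_eq_add, hermForm_add_left, hx, ← conj_hermForm σ H hσ hH x y, ht, hβσ, ← two_mul]
      exact isUnit_iff_ne_zero.2 (mul_ne_zero h2 hβ)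
    obtain ⟨g₁, hg₁, hg₁x⟩ := exists_mem_unitaryGroupOfForm_mulVec_eq_of_isUnit σ H hσ hH hxy' hc
    have hyy : hermForm σ H y y ≠ 0 := by rw [hy]; exact hβ
    obtain ⟨g₂, hg₂, hg₂y⟩ := exists_mem_unitaryGroupOfForm_mulVec_eq_neg σ H hσ hH (map_two σ) hyy
    refine ⟨g₂ * g₁, (unitaryGroupOfForm σ H).mul_mem hg₂ hg₁, ?_⟩
    rw [Units.val_mul, ← Matrix.mulVec_mulVec, hg₁x, Matrix.mulVec_neg, hg₂y, neg_neg]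
  · -- one step along `x − y`
    have hxy : hermForm σ H x x = hermForm σ H y y := by rw [hx, hy]
    have hc : IsUnit (hermForm σ H (x - y) x) := by
      rw [hermForm_sub_left, hx, ← conj_hermForm σ H hσ hH x y]
      refine isUnit_iff_ne_zero.2 (sub_ne_zero.2 fun h => ht ?_)
      have h' := congrArg σ h
      rwa [hσ, hβσ, eq_comm] at h'
    exact exists_mem_unitaryGroupOfForm_mulVec_eq_of_isUnit σ H hσ hH hxy hc

/-- **Orbit form**: for `h(x,x) ≠ 0`, `y` lies in the `U(σ, H)`-orbit of `x` iff `h(y,y) = h(x,x)`.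
[cite: Dieudonne1971GroupesClassiques, Chap. II §4 n° 7–8] [cite: Scharlau1985HermitianForms, Ch. 7 §9] -/
theorem exists_mem_unitaryGroupOfForm_mulVec_eq_iff (hσ : ∀ s, σ (σ s) = s) (hH : (H.map σ)ᵀ = H) (h2 : (2 : K) ≠ 0)
    {x y : n → K} (hx : hermForm σ H x x ≠ 0) :
    (∃ g ∈ unitaryGroupOfForm σ H, (g : Matrix n n K) *ᵥ x = y) ↔ hermForm σ H y y = hermForm σ H x x := by
  constructor
  · rintro ⟨g, hg, rfl⟩
    exact (mem_unitaryGroupOfForm_iff_hermForm σ H g).1 hg x x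
  · intro hy
    exact exists_mem_unitaryGroupOfForm_mulVec_eq σ H hσ hH h2 rfl hy hx

/-- **Two vectors of the same non-zero length are conjugate by an isometry fixing every vector orthogonal to both**
is NOT claimed; what is recorded is the weaker by-product of the construction: the witness is a product of at most two
quasi-reflections, each along a vector of `span{x, y}`, hence fixes `{x, y}^⊥` pointwise.
[cite: Dieudonne1971GroupesClassiques, Chap. II §4 n° 7–8] -/
theorem exists_mem_unitaryGroupOfForm_mulVec_eq_and_fix (hσ : ∀ s, σ (σ s) = s) (hH : (H.map σ)ᵀ = H)
    (h2 : (2 : K) ≠ 0) {x y : n → K} {β : K} (hx : hermForm σ H x x = β) (hy : hermForm σ H y y = β) (hβ : β ≠ 0) :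
    ∃ g ∈ unitaryGroupOfForm σ H, (g : Matrix n n K) *ᵥ x = y ∧
      ∀ z : n → K, hermForm σ H x z = 0 → hermForm σ H y z = 0 → (g : Matrix n n K) *ᵥ z = z := by
  have hβσ : σ β = β := by rw [← hx]; exact conj_hermForm_self σ H hσ hH x
  by_cases ht : hermForm σ H x y = β
  · -- two quasi-reflections: along `x + y`, then along `y`
    have hxy' : hermForm σ H x x = hermForm σ H (-y) (-y) := by
      rw [hermForm_neg_left, hermForm_neg_right, neg_neg, hx, hy]
    have hc : IsUnit (hermForm σ H (x - -y) x) := by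
      rw [sub_neg_eq_add, hermForm_add_left, hx, ← conj_hermForm σ H hσ hH x y, ht, hβσ, ← two_mul]
      exact isUnit_iff_ne_zero.2 (mul_ne_zero h2 hβ)
    have hrel₁ := quasiRefl_relation_of_isUnit σ H hσ hH hxy' hc
    obtain ⟨g₁, hg₁, hcoe₁⟩ := exists_mem_unitaryGroupOfForm_coe_eq_quasiRefl σ H hσ hH hrel₁
    have hyy : hermForm σ H y y ≠ 0 := by rw [hy]; exact hβ
    have ha₂ : (-(2 / hermForm σ H y y)) + σ (-(2 / hermForm σ H y y)) +
        (-(2 / hermForm σ H y y)) * σ (-(2 / hermForm σ H y y)) * hermForm σ H y y = 0 := by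
      rw [map_neg, map_div₀, map_two, hy, hβσ]
      field_simp
      ring
    obtain ⟨g₂, hg₂, hcoe₂⟩ := exists_mem_unitaryGroupOfForm_coe_eq_quasiRefl σ H hσ hH ha₂
    refine ⟨g₂ * g₁, (unitaryGroupOfForm σ H).mul_mem hg₂ hg₁, ?_, fun z hxz hyz => ?_⟩
    · rw [Units.val_mul, ← Matrix.mulVec_mulVec, hcoe₁, quasiRefl_mulVec, neg_mul, IsUnit.val_inv_mul, neg_smul,
        one_smul, hcoe₂, show x + -(x - -y) = -y by abel, Matrix.mulVec_neg, quasiRefl_mulVec_self, hy]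
      have h1 : (1 + -(2 / β) * β) = (-1 : K) := by field_simp; ring
      rw [h1, neg_one_smul, neg_neg]
    · have hvz : hermForm σ H (x - -y) z = 0 := by rw [sub_neg_eq_add, hermForm_add_left, hxz, hyz, add_zero]
      rw [Units.val_mul, ← Matrix.mulVec_mulVec, hcoe₁, quasiRefl_mulVec_of_orth σ H _ _ hvz, hcoe₂,
        quasiRefl_mulVec_of_orth σ H _ _ hyz]
  · -- one quasi-reflection along `x − y`
    have hxy : hermForm σ H x x = hermForm σ H y y := by rw [hx, hy]
    have hc : IsUnit (hermForm σ H (x - y) x) := by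
      rw [hermForm_sub_left, hx, ← conj_hermForm σ H hσ hH x y]
      refine isUnit_iff_ne_zero.2 (sub_ne_zero.2 fun h => ht ?_)
      have h' := congrArg σ h
      rwa [hσ, hβσ, eq_comm] at h'
    have hrel := quasiRefl_relation_of_isUnit σ H hσ hH hxy hc
    obtain ⟨g, hg, hcoe⟩ := exists_mem_unitaryGroupOfForm_coe_eq_quasiRefl σ H hσ hH hrel
    refine ⟨g, hg, ?_, fun z hxz hyz => ?_⟩
    · rw [hcoe, quasiRefl_mulVec, neg_mul, IsUnit.val_inv_mul, neg_smul, one_smul]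
      abel
    · have hvz : hermForm σ H (x - y) z = 0 := by rw [hermForm_sub_left, hxz, hyz, sub_zero]
      rw [hcoe, quasiRefl_mulVec_of_orth σ H _ _ hvz]

end Field

end Literature.NumberTheory.Automorphic.UnitaryGroup
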